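import Literature.NumberTheory.EllipticCurves.AnticyclotomicSignedLocalisationKernelStrictProofs
import HarnessLib

/-!
# Castella–Wan 2024, proof of Thm. 6.8 (MS p. 30): "the quotient `Sel^{±,rel}(K, 𝐓^ac)/Sel_±(K, 𝐓^ac)`
# injects into `H¹(K_𝔭̄, 𝐓^ac)/H¹_±(K_𝔭̄, 𝐓^ac)`" — PROVED on the tree's carriers (Kummer descent along
# the chosen embedding), and INPUTS row G67 reduced to EXISTING named facts plus the LOCAL statement of
# Prop. 3.8 at `𝔭̄` ("`H¹(K_𝔭̄, 𝐓^ac)/H¹_±` has trivial `Λ^ac`-torsion")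

`Proofs`-style companion no. 4 of `AnticyclotomicSignedSelmerRelaxedEquality.lean` (INPUTS row G67 of the BSD
cell `pub/bsd-wall/bsd-inputs`; consumer stmt-BirchSwinnertonDyer-20727 `stub_namedFactsSS` conj. 7; seat
`bsd-input-cw24-lem67-thm68`). THEOREMS ONLY (no definition, no named fact, no instance, no `sorry`).
HONEST FRAMING: the fact is NOT discharged; BSD is not proved by this file.

## What is proved

In the reductions `…_of_rankOne_of_saturated` / `…_of_torsion_locKer_of_saturated` / `…_of_thmA5_of_saturated`
(companions 1–3) the input `hC` — "`Sel_ε(K, 𝐓^ac)` is `Λ`-saturated in `Sel^{ε, rel at 𝔭'}(K, 𝐓^ac)`" —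
stood for print's two sentences "the quotient `Sel^{±,rel}/Sel_±` injects into `H¹(K_𝔭̄, 𝐓^ac)/H¹_±(K_𝔭̄,
𝐓^ac)`" AND "which has trivial `Λ^ac`-torsion by Proposition 3.8". This file PROVES the first sentence on
the carriers and thereby reduces `hC` to the second, a statement about the LOCAL modules only:
"`H¹_ε(K_𝔭', 𝐓^ac) = localSignedLambdaAdic` is `Λ`-saturated in `H¹(K_𝔭', 𝐓^ac) = localLambdaAdic`"
(structures `localLambdaAdic.moduleOfGen`). The injection is the statement that a family
`x ∈ Sel^{ε,rel at 𝔭'}` whose localisation `loc_{𝔭'} x` satisfies the local signed condition satisfies the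
GLOBAL signed condition at `𝔭'` — the converse of the tree's `locLevel_mem_localCondTorsion_of_mem_condAboveTorsion`
— which needs (§1) a Kummer descent along the chosen embedding `ι : K̄ → K̄_{𝔭'}` (a class of
`H¹(K_∞, E[p^∞])` whose localisation is the Kummer class of a local point IS, at the chosen place, the
Kummer class of a local point: cocycle classes with equal image differ by the coboundary of a torsion
point over `K̄_{𝔭'}`, which comes from `K̄` — `primaryTorsionMapOfEmb_closureEmb_surjective`) and (§2)
the passage from the chosen place to all its `Γ_K`-conjugates (one prime of `K_∞` above `𝔭'`:
`σ = σ_E| · τ` with `τ ∈ Gal(K̄/K_∞)` acting trivially, `conjH1_of_mem_holds`).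

## Contents

* §0 small transport lemmas (`pointsMapOfEmb` at the identity embedding is the identity;
  `toLocalCurvePoints` is onto; `E^ε(K_∞·K_v)` corresponds under `toLocalCurvePoints`).
* §1 `mem_localKummerOverOfEmb_of_locInfty_mem` (Kummer descent along `closureEmb`).
* §2 `mem_condAboveTorsion_sgn_of_locLevel_mem_localCondTorsion` (levelwise converse transfer) and
  `mem_condAboveTorsion_sgn_iff_locLevel_mem` (iff).
* §3 `selmerLambdaAdic_sgn_saturated_of_localSignedLambdaAdic_saturated`: `hC` from LOCAL saturation.
* §4 `castellaWan2024_proofThm68_selmerRel_le_selmerSgn_of_thmA5_of_localSaturated`: INPUTS row G67 from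
  `IsNonsplitIn κ 𝔭`, `IsNonsplitIn κ 𝔭'`, `Squarefree N`, the existing named facts
  `iovitaPollack2006_lemma21_noPTorsion_top` (proved), `castellaWan2024_thmA5_thm68_bdp_mem_charIdeal`,
  `castellaWan2024_sec61_localSignedLambdaAdic_free_rank_one`, and local saturation at `𝔭'`.

References: [CastellaWan2023] proof of Thm. 6.8 (MS p. 30), Prop. 3.8 (MS p. 15), Def. 4.6/(4.7) (MS pp.
21–22), Def. 5.1 (MS p. 23); [Kobayashi2003] Def. 1.1; [BDKim2013] Def. 3.3; [SilvermanAEC2009] VIII.§2,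
X.§4, Cor. III.6.4 (b); [SerreLocalFields1979] VII.§5 Prop. 3.
-/

noncomputable section

open scoped Classical

open PowerSeries NumberField IsDedekindDomain Field
open Literature.NumberTheory.EllipticCurves Literature.NumberTheory.GaloisRepresentations
open Literature.NumberTheory.EllipticCurves.ModularForms Literature.NumberTheory.EllipticCurves.Castella2018
open Literature.NumberTheory.EllipticCurves.GreenbergSelmer
open Literature.NumberTheory.EllipticCurves.CocycleCriteria
open Literature.NumberTheory.EllipticCurves.Kobayashi2003
open WeierstrassCurve (geomTorsion geomPoints)

universe u

namespace Literature.NumberTheory.EllipticCurves.AcSigned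

/-! ## §0 Transport lemmas at the identity embedding -/

section Transport

variable {K : Type u} [Field K] (W : WeierstrassCurve K) (p : ℕ) [Fact p.Prime] (κ : ZpExtension K p)
  {E : Type u} [Field E] [Algebra K E]

omit [Fact p.Prime] in
/-- The points map of the identity embedding `K̄_E → K̄_E` is the identity. [cite: SilvermanAEC2009, X.§4 (Remark 4.1.1)] -/
theorem pointsMapOfEmb_id_apply (V : WeierstrassCurve E) (P : geomPoints V) :
    pointsMapOfEmb V (AlgHom.id E (AlgebraicClosure E)) P = P := by
  rcases P with _ | ⟨h⟩ <;> rfl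

omit [Fact p.Prime] in
/-- `toLocalCurvePoints : E(K̄_E) → E_E(K̄_E)` is onto (it is the identity on coordinates).
[cite: SilvermanAEC2009, X.§4 (Remark 4.1.1)] -/
theorem toLocalCurvePoints_surjective : Function.Surjective (toLocalCurvePoints (E := E) W) := by
  intro Q
  refine ⟨W.geomPointsToLocalPoints (E := E) Q, ?_⟩
  rw [toLocalCurvePoints_apply, WeierstrassCurve.localPointsToGeomPoints_geomPointsToLocalPoints]
  exact pointsMapOfEmb_id_apply (W.baseChange E) Q

end Transport

/-! ## §1 Kummer descent along the chosen embedding -/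

section Descent

variable {K : Type u} [Field K] [NumberField K] (W : WeierstrassCurve K) (p : ℕ) [Fact p.Prime]
  (κ : ZpExtension K p) {E : Type u} [Field E] [Algebra K E]

omit [NumberField K] in
/-- **Kummer descent along `ι : K̄ → K̄_E` (the chosen embedding).** Let `c ∈ H¹(K_∞, E[p^∞])` and suppose
its localisation `loc c ∈ H¹(K_∞·E, E_E[p^∞])` (`locInfty` at `closureEmb E`) is, on `Gal(K̄_E/K_∞·E)`, the
Kummer class of a local point: `loc c ∈ localKummerOverOfEmb (W_E) … id A'`. Then `c` itself is, at the place
of `ι`, the Kummer class of a local point: `c ∈ localKummerOverOfEmb W … ι A` for any `A ⊆ E(K̄_E)` containing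
the preimage of `A'` under the identification `E(K̄_E) = E_E(K̄_E)` (`toLocalCurvePoints`). Proof: a
representative `φ` of `c` pulls back to a cocycle `φ_E` with `[φ_E] = loc c = [ψ]`, `ψ(τ) = τQ' − Q'`; so
`φ_E − ψ` is the coboundary of a torsion point `t'` of `E_E` over `K̄_E`, and `ι(φ(τ|)) = τ(Q' + t') − (Q' + t')`.
(`E = W` an elliptic curve, `E/K` a number field, `char E = 0`, so that the identifications are available.)
[cite: Kobayashi2003, Def. 1.1 (the Kummer condition)] [cite: SilvermanAEC2009, VIII.§2 and X.§4] -/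
theorem mem_localKummerOverOfEmb_of_locInfty_mem [W.IsElliptic] [CharZero E]
    (h : Function.Surjective (κ.toContinuousMonoidHom.comp (resGalOfEmb (closureEmb (K := K) E))))
    {A : AddSubgroup (localPoints W E)} {A' : AddSubgroup (localPoints (W.baseChange E) E)}
    (hA : ∀ Q : localPoints W E, toLocalCurvePoints W Q ∈ A' → Q ∈ A)
    {c : W.subgroupH1 p κ.kerSubgroup}
    (hc : locInfty W p κ (closureEmb (K := K) E) h c ∈
      localKummerOverOfEmb (W.baseChange E) p (κ.localize (closureEmb (K := K) E) h).kerSubgroup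
        (AlgHom.id E (AlgebraicClosure E)) A') :
    c ∈ localKummerOverOfEmb W p κ.kerSubgroup (closureEmb (K := K) E) A := by
  obtain ⟨φ, rfl⟩ := oneCocycleClass_surjective (discreteTopRep κ.kerSubgroup (W.geomPrimaryTorsion p)) c
  obtain ⟨ψ, Q', k', hψ, hA', hτ'⟩ := hc
  -- the pulled-back cocycle `φ_E(τ) = ι_*(φ(τ|))` represents `loc [φ]`
  set φE : contOneCocycles (discreteTopRep (κ.localize (closureEmb (K := K) E) h).kerSubgroup
      ((W.baseChange E).geomPrimaryTorsion p)) :=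
    contOneCocycles.pullback (resGalSubgroupOfEmb κ.kerSubgroup (closureEmb (K := K) E))
      (resHomOfEquivariant (resGalSubgroupOfEmb κ.kerSubgroup (closureEmb (K := K) E))
        (primaryTorsionMapOfEmb W p (closureEmb (K := K) E))
        (primaryTorsionMapOfEmb_smul W p κ (closureEmb (K := K) E))) φ with hφEdef
  have hφE : ∀ τ, φE.1 τ = primaryTorsionMapOfEmb W p (closureEmb (K := K) E)
      (φ.1 (resGalSubgroupOfEmb κ.kerSubgroup (closureEmb (K := K) E) τ)) := fun _ ↦ rfl
  have hloc : oneCocycleClass _ φE = locInfty W p κ (closureEmb (K := K) E) h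
      (oneCocycleClass (discreteTopRep κ.kerSubgroup (W.geomPrimaryTorsion p)) φ) := by
    change _ = (ContinuousCohomology.map (resGalSubgroupOfEmb κ.kerSubgroup (closureEmb (K := K) E))
      (resHomOfEquivariant (resGalSubgroupOfEmb κ.kerSubgroup (closureEmb (K := K) E))
        (primaryTorsionMapOfEmb W p (closureEmb (K := K) E))
        (primaryTorsionMapOfEmb_smul W p κ (closureEmb (K := K) E))) 1).hom
      (oneCocycleClass (discreteTopRep κ.kerSubgroup (W.geomPrimaryTorsion p)) φ)
    rw [map_oneCocycleClass]
    rfl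
  -- `[φ_E] = [ψ]`, so `φ_E - ψ` is the coboundary of a torsion point `t'`
  have h0 : oneCocycleClass _ (φE - ψ) = 0 := by
    rw [oneCocycleClass_sub, hloc, hψ, sub_self]
  obtain ⟨t', ht'⟩ := (oneCocycleClass_eq_zero_iff _ _).1 h0
  -- the points: `Q₀ ↦ Q'`, `Q₁ ↦ t'` under `toLocalCurvePoints`
  obtain ⟨Q₀, hQ₀⟩ := toLocalCurvePoints_surjective W Q'
  obtain ⟨Q₁, hQ₁⟩ := toLocalCurvePoints_surjective W
    (pointsMapOfEmb (W.baseChange E) (AlgHom.id E (AlgebraicClosure E)) (t' : geomPoints (W.baseChange E)))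
  obtain ⟨j, hj⟩ :=
    (AddCommGroup.mem_primaryComponent (G := geomPoints (W.baseChange E)) (p := p)).mp t'.2
  have hQ₁tors : p ^ j • Q₁ = 0 := by
    apply toLocalCurvePoints_injective W
    rw [map_nsmul, hQ₁, map_zero, ← map_nsmul, hj, map_zero]
  refine ⟨φ, Q₀ + Q₁, k' + j, rfl, ?_, fun τ ↦ ?_⟩
  · -- `p^(k'+j) (Q₀ + Q₁) = p^j (p^k' Q₀)` lies in `A` because its image `p^j (p^k' Q')` lies in `A'`
    apply hA
    rw [smul_add, pow_add, mul_smul, mul_smul, hQ₁tors, smul_zero, add_zero, map_nsmul, map_nsmul, hQ₀,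
      smul_comm]
    exact A'.nsmul_mem hA' _
  · -- the Kummer identity at `τ ∈ Gal(K̄_E/K_∞·E)`, checked after `toLocalCurvePoints` (injective)
    -- `ψ(τ) = τ Q' - Q'` (the element `τ` read in `Gal(K̄_E/K_∞·E) = (κ_E).kerSubgroup`, two definitionally
    -- equal presentations of one subgroup of `Γ_E`)
    have hτmem : (τ : absoluteGaloisGroup E) ∈
        localSubgroupOfEmb (κ.localize (closureEmb (K := K) E) h).kerSubgroup
          (AlgHom.id E (AlgebraicClosure E)) := by
      rw [mem_localSubgroupOfEmb_iff, resGalOfEmb_id_apply]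
      exact τ.2
    have e2 := hτ' ⟨τ, hτmem⟩
    have e3 : resGalSubgroupOfEmb (κ.localize (closureEmb (K := K) E) h).kerSubgroup
        (AlgHom.id E (AlgebraicClosure E)) ⟨τ, hτmem⟩ = τ :=
      Subtype.ext (resGalOfEmb_id_apply (τ : absoluteGaloisGroup E))
    rw [e3] at e2
    -- `φ_E(τ) - ψ(τ) = τ t' - t'`
    have e1 : ((φE.1 τ : (W.baseChange E).geomPrimaryTorsion p) : geomPoints (W.baseChange E)) =
        (ψ.1 τ : geomPoints (W.baseChange E)) +
          ((τ : absoluteGaloisGroup E) • (t' : geomPoints (W.baseChange E)) - t') := by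
      have h1 := congrArg (fun z : (W.baseChange E).geomPrimaryTorsion p ↦ (z : geomPoints (W.baseChange E)))
        (ht' τ)
      have h4 : (((discreteTopRep (κ.localize (closureEmb (K := K) E) h).kerSubgroup
          ((W.baseChange E).geomPrimaryTorsion p)).ρ τ t' : (W.baseChange E).geomPrimaryTorsion p) :
          geomPoints (W.baseChange E)) =
          (τ : absoluteGaloisGroup E) • (t' : geomPoints (W.baseChange E)) := rfl
      simp only [ContinuousMap.sub_apply, AddSubgroupClass.coe_sub, h4] at h1
      rw [← h1]
      abel
    -- transport of the `Γ_E`-action on torsion points through the identity points map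
    have hb : pointsMapOfEmb (W.baseChange E) (AlgHom.id E (AlgebraicClosure E))
        ((τ : absoluteGaloisGroup E) • (t' : geomPoints (W.baseChange E))) =
        (τ : absoluteGaloisGroup E) • pointsMapOfEmb (W.baseChange E) (AlgHom.id E (AlgebraicClosure E))
          (t' : geomPoints (W.baseChange E)) := by
      have hs := pointsMapOfEmb_smul (W.baseChange E) (AlgHom.id E (AlgebraicClosure E))
        (τ : absoluteGaloisGroup E) (t' : geomPoints (W.baseChange E))
      rwa [resGalOfEmb_id_apply] at hs
    apply toLocalCurvePoints_injective W
    rw [map_sub, toLocalCurvePoints_smul, map_add, hQ₀, hQ₁, toLocalCurvePoints_apply,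
      ← WeierstrassCurve.geomPointsMapOfEmb_apply, ← coe_primaryTorsionMapOfEmb, ← hφE, e1, map_add,
      map_sub, hb, e2, smul_add]
    abel

end Descent

/-! ## §2 The levelwise converse transfer: local signed condition ⟹ global signed condition at `v` -/

section Levelwise

variable {K : Type u} [Field K] [NumberField K] (W : WeierstrassCurve K) (p : ℕ) [Fact p.Prime]
  (κ : ZpExtension K p) {E : Type u} [Field E] [Algebra K E]

omit [NumberField K] in
/-- **`E^ε(K_∞·E)` corresponds under `E(K̄_E) = E_E(K̄_E)`** (the `K_∞`-level of the tree's layerwise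
`toLocalCurvePoints_mem_signedLocalPointsOfEmb_iff`): a local point whose avatar on the local curve lies in
`E_E^ε` of the localised tower lies in `E^ε(K_∞·E)` (induction over the union `⋃_n E^ε(K_n·E)`).
[cite: BDKim2013, §2 Def. 2.1 and the line after it (p. 192)] -/
theorem mem_signedLocalPointsInfty_of_toLocalCurvePoints_mem
    (h : Function.Surjective (κ.toContinuousMonoidHom.comp (resGalOfEmb (closureEmb (K := K) E))))
    (ε : ℤˣ) (Q : localPoints W E)
    (hQ : toLocalCurvePoints W Q ∈ signedLocalPointsInfty (κ.localize (closureEmb (K := K) E) h)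
      (AlgHom.id E (AlgebraicClosure E)) (W.baseChange E) ε) :
    Q ∈ signedLocalPointsInfty κ (closureEmb (K := K) E) W ε := by
  suffices hC : ∀ R : localPoints (W.baseChange E) E,
      R ∈ signedLocalPointsInfty (κ.localize (closureEmb (K := K) E) h) (AlgHom.id E (AlgebraicClosure E))
        (W.baseChange E) ε →
      ∀ Q : localPoints W E, toLocalCurvePoints W Q = R → Q ∈ signedLocalPointsInfty κ (closureEmb (K := K) E) W ε
    from hC _ hQ Q rfl
  intro R hR
  refine AddSubgroup.iSup_induction (C := fun R ↦ ∀ Q : localPoints W E, toLocalCurvePoints W Q = R →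
      Q ∈ signedLocalPointsInfty κ (closureEmb (K := K) E) W ε) _ hR (fun n R hRn Q hQR ↦ ?_)
    (fun Q hQ0 ↦ ?_) (fun R₁ R₂ h₁ h₂ Q hQR ↦ ?_)
  · rw [← hQR, toLocalCurvePoints_mem_signedLocalPointsOfEmb_iff W p κ _ h ε n Q] at hRn
    exact signedLocalPointsOfEmb_le_signedLocalPointsInfty κ _ W ε n hRn
  · have hQ : Q = 0 := toLocalCurvePoints_injective W (by rw [hQ0, map_zero])
    rw [hQ]
    exact AddSubgroup.zero_mem _
  · obtain ⟨Q₁, hQ₁⟩ := toLocalCurvePoints_surjective W R₁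
    have hQ₂ : toLocalCurvePoints W (Q - Q₁) = R₂ := by
      rw [map_sub, hQR, hQ₁, add_sub_cancel_left]
    have hQeq : Q = Q₁ + (Q - Q₁) := by abel
    rw [hQeq]
    exact AddSubgroup.add_mem _ (h₁ Q₁ hQ₁) (h₂ (Q - Q₁) hQ₂)

/-- **The local signed condition on `loc_v x` implies the GLOBAL signed condition at `v`, levelwise** — the
converse of the tree's `locLevel_mem_localCondTorsion_of_mem_condAboveTorsion`: if the localisation
`loc_{n,m} x ∈ H¹(K_{n,w}, E_w[p^m])` of `x ∈ H¹(K_n, E[p^m])` lies in `ℋ^ε_n[p^m]` of the localised tower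
(`localCondTorsion`), then EVERY `Γ_K`-conjugate of `θ_{n,m}(x)` satisfies the signed Kummer condition at the
chosen place above `v` (`condAboveTorsion … v (.sgn ε) n m`). One prime of `K_∞` above `v` (`IsNonsplitIn`):
`σ = σ_v| · τ` with `τ ∈ Gal(K̄/K_∞)`, and `τ` acts trivially on `H¹(K_∞, ·)` (`conjH1_of_mem_holds`), so the
conjugate by `σ` is the conjugate by `σ_v|`, whose localisation is the `σ_v`-conjugate of `loc θ(x)`
(`locInfty_conjH1`); then §1. [cite: CastellaWan2023, Def. 4.6/(4.7) and Lemma 4.7 (MS pp. 21–22)]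
[cite: HatleyLeiVigni2022, Def. 3.4 and Remark 3.1] [cite: SerreLocalFields1979, VII.§5 Prop. 3] -/
theorem mem_condAboveTorsion_sgn_of_locLevel_mem_localCondTorsion [W.IsElliptic]
    (v : HeightOneSpectrum (𝓞 K)) (hv : IsNonsplitIn κ v) (ε : ℤˣ) (n m : ℕ)
    {x : W.torsionH1Over ((p : ℤ) ^ m) (κ.layerSubgroup n)}
    (hx : locLevel W p κ (closureEmb (K := K) (v.adicCompletion K)) hv n m x ∈
      localCondTorsion (W.baseChange (v.adicCompletion K)) p (localizeAt κ v hv) ε n m) :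
    x ∈ condAboveTorsion W p κ v (.sgn ε) n m := by
  haveI : CharZero (v.adicCompletion K) :=
    charZero_of_injective_algebraMap (algebraMap K (v.adicCompletion K)).injective
  rw [mem_condAboveTorsion_iff, mem_condAbove_sgn_iff]
  intro σ
  -- `σ = σ_v| · τ` with `τ ∈ Gal(K̄/K_∞)` acting trivially
  obtain ⟨σv, hσv⟩ := exists_apply_resGalOfEmb_closureEmb_eq (p := p) (κ := κ) v hv σ
  have hτ : (resGalOfEmb (closureEmb (K := K) (v.adicCompletion K)) σv)⁻¹ * σ ∈ κ.kerSubgroup := by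
    rw [ZpExtension.mem_kerSubgroup, map_mul, map_inv, hσv, inv_mul_cancel]
  have hσ : σ = resGalOfEmb (closureEmb (K := K) (v.adicCompletion K)) σv *
      ((resGalOfEmb (closureEmb (K := K) (v.adicCompletion K)) σv)⁻¹ * σ) := by group
  rw [hσ, conjH1_mul_holds κ.kerSubgroup (W.geomPrimaryTorsion p), AddMonoidHom.comp_apply,
    conjH1_of_mem_holds κ.kerSubgroup (W.geomPrimaryTorsion p) hτ, AddMonoidHom.id_apply]
  -- the conjugate by `σ_v|`: Kummer descent (§1) from the `σ_v`-conjugate of the local condition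
  rw [mem_localCondTorsion_iff, mem_localSignedKummer_iff] at hx
  refine mem_localKummerOverOfEmb_of_locInfty_mem W p κ hv
    (fun Q hQ ↦ mem_signedLocalPointsInfty_of_toLocalCurvePoints_mem W p κ hv ε Q hQ) ?_
  rw [locInfty_conjH1, ← toInfty_locLevel]
  exact hx σv

/-- **`x ∈ condAboveTorsion … v (.sgn ε) n m ↔ loc_{n,m} x ∈ ℋ^ε_n[p^m]`**: the global signed condition at
`v` IS a condition on the localisation at the chosen place (Hatley–Lei–Vigni Def. 3.4), for an elliptic
curve over a number field and a prime `v` with one prime of `K_∞` above it.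
[cite: HatleyLeiVigni2022, Def. 3.4 and Remark 3.1] [cite: CastellaWan2023, Lemma 4.7 (MS p. 22)] -/
theorem mem_condAboveTorsion_sgn_iff_locLevel_mem [W.IsElliptic] (v : HeightOneSpectrum (𝓞 K))
    (hv : IsNonsplitIn κ v) (ε : ℤˣ) (n m : ℕ) (x : W.torsionH1Over ((p : ℤ) ^ m) (κ.layerSubgroup n)) :
    x ∈ condAboveTorsion W p κ v (.sgn ε) n m ↔
      locLevel W p κ (closureEmb (K := K) (v.adicCompletion K)) hv n m x ∈
        localCondTorsion (W.baseChange (v.adicCompletion K)) p (localizeAt κ v hv) ε n m :=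
  ⟨locLevel_mem_localCondTorsion_of_mem_condAboveTorsion W p κ v hv ε n m,
    mem_condAboveTorsion_sgn_of_locLevel_mem_localCondTorsion W p κ v hv ε n m⟩

end Levelwise

/-! ## §3 `Sel_ε` is `Λ`-saturated in `Sel^{ε, rel at v}` if `H¹_ε(K_v, 𝐓^ac)` is `Λ`-saturated in `H¹(K_v, 𝐓^ac)` -/

section Saturation

variable {K : Type u} [Field K] [NumberField K] (W : WeierstrassCurve K) (p : ℕ) [Fact p.Prime]
  (κ : ZpExtension K p)

/-- **"The quotient `Sel^{±,rel}(K, 𝐓^ac)/Sel_±(K, 𝐓^ac)` injects into `H¹(K_𝔭̄, 𝐓^ac)/H¹_±(K_𝔭̄, 𝐓^ac)`"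
(Castella–Wan, proof of Thm. 6.8, MS p. 30), in the form the reductions use.** For a prime `v ∋ p` with one
prime of `K_∞` above it (local generator `γ_v` matching `γ`) and the constructed `Λ`-structures
(`selmerLambdaAdic.moduleOfGen hγ`, `localLambdaAdic.moduleOfGen`): IF the local signed module
`H¹_ε(K_v, 𝐓^ac) = localSignedLambdaAdic` is `Λ`-saturated in `H¹(K_v, 𝐓^ac) = localLambdaAdic` (`g ≠ 0`,
`g • y ∈ H¹_ε ⟹ y ∈ H¹_ε` — print: "`H¹(K_𝔭̄, 𝐓^ac)/H¹_±(K_𝔭̄, 𝐓^ac)` … has trivial `Λ^ac`-torsion by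
Proposition 3.8"), THEN `Sel_ε(K, 𝐓^ac)` is `Λ`-saturated in `Sel^{ε, rel at v}(K, 𝐓^ac)`: for `x ∈ Sel^{ε,rel at v}`
with `g • x ∈ Sel_ε`, `loc_v(g • x) = g • loc_v x ∈ H¹_ε` (`loc_smul`, `locAt_mem_localSignedLambdaAdic`), so
`loc_v x ∈ H¹_ε`, i.e. levelwise `loc_{n,m} x_{n,m} ∈ ℋ^ε_n[p^m]`, which IS the global signed condition at `v`
(§2, `mem_condAboveTorsion_sgn_of_locLevel_mem_localCondTorsion`); the other conditions of `Sel_ε` are those of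
`Sel^{ε,rel at v}`. [cite: CastellaWan2023, proof of Thm. 6.8 (MS p. 30) and Prop. 3.8 (MS p. 15)] -/
theorem selmerLambdaAdic_sgn_saturated_of_localSignedLambdaAdic_saturated [W.IsElliptic]
    (v : HeightOneSpectrum (𝓞 K)) (hv : IsNonsplitIn κ v) (hvp : ((p : ℕ) : 𝓞 K) ∈ v.asIdeal)
    {γ : absoluteGaloisGroup K} (hγ : κ.IsTopGenerator γ) {γv : absoluteGaloisGroup (v.adicCompletion K)}
    (hγv : κ (resGalOfEmb (closureEmb (K := K) (v.adicCompletion K)) γv) = κ γ) (ε : ℤˣ)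
    (hloc : ∀ (g : IwasawaAlgebra p), g ≠ 0 →
      ∀ y : localLambdaAdic (W.baseChange (v.adicCompletion K)) p (localizeAt κ v hv) γv,
        (letI := localLambdaAdic.moduleOfGen (W.baseChange (v.adicCompletion K)) p (localizeAt κ v hv) γv
            (isTopGenerator_localize_of_apply_eq p κ _ hv hγv hγ)
         (g • y).1) ∈ localSignedLambdaAdic (W.baseChange (v.adicCompletion K)) p (localizeAt κ v hv) γv ε →
        y.1 ∈ localSignedLambdaAdic (W.baseChange (v.adicCompletion K)) p (localizeAt κ v hv) γv ε)
    (g : IwasawaAlgebra p) (hg : g ≠ 0) (x : selmerLambdaAdic W p κ γ (PCond.at v .rel (.sgn ε)))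
    (hgx : (letI := selmerLambdaAdic.moduleOfGen W p κ γ hγ (PCond.at v .rel (.sgn ε)); (g • x).1) ∈
      selmerLambdaAdic W p κ γ (fun _ ↦ .sgn ε)) :
    x.1 ∈ selmerLambdaAdic W p κ γ (fun _ ↦ .sgn ε) := by
  letI instS := selmerLambdaAdic.moduleOfGen W p κ γ hγ (PCond.at v .rel (.sgn ε))
  letI instH := localLambdaAdic.moduleOfGen (W.baseChange (v.adicCompletion K)) p (localizeAt κ v hv) γv
    (isTopGenerator_localize_of_apply_eq p κ _ hv hγv hγ)
  -- `loc_v (g • x) = g • loc_v x` lies in `H¹_ε(K_v, 𝐓^ac)` because `g • x ∈ Sel_ε`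
  have hval : (g • locAt W p κ v hv γ γv hγv (PCond.at v .rel (.sgn ε)) x).1 =
      (locAt W p κ v hv γ γv hγv (PCond.at v .rel (.sgn ε)) (g • x)).1 := by
    have h := loc_smul W p κ (closureEmb (K := K) (v.adicCompletion K)) hv hγv hγ
      (C := fun n m ↦ selmerTorsion W p κ (PCond.at v .rel (.sgn ε)) n m)
      (fun _ _ _ hy ↦ conjH1_mem_selmerTorsion γ hy) g x
    have h' := congrArg Subtype.val h
    exact h'.symm
  have hmem : (locAt W p κ v hv γ γv hγv (fun _ ↦ .sgn ε)
      (⟨(g • x).1, hgx⟩ : selmerLambdaAdic W p κ γ (fun _ ↦ .sgn ε))).1 ∈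
      localSignedLambdaAdic (W.baseChange (v.adicCompletion K)) p (localizeAt κ v hv) γv ε :=
    locAt_mem_localSignedLambdaAdic W p κ v hv hγv (L := fun _ ↦ .sgn ε) rfl hvp ⟨(g • x).1, hgx⟩
  have hgy : (g • locAt W p κ v hv γ γv hγv (PCond.at v .rel (.sgn ε)) x).1 ∈
      localSignedLambdaAdic (W.baseChange (v.adicCompletion K)) p (localizeAt κ v hv) γv ε := by
    rw [hval]
    exact hmem
  -- hence `loc_v x ∈ H¹_ε(K_v, 𝐓^ac)` (local saturation), levelwise `loc_{n,m} x_{n,m} ∈ ℋ^ε_n[p^m]`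
  have hy := (mem_localSignedLambdaAdic_iff _).1 (hloc g hg _ hgy)
  -- assemble `x ∈ Sel_ε`
  have hx2 := (mem_lambdaAdic_iff (C := fun n m ↦ selmerTorsion W p κ (PCond.at v .rel (.sgn ε)) n m) x.1).1 x.2
  refine (mem_lambdaAdic_iff (C := fun n m ↦ selmerTorsion W p κ (fun _ ↦ .sgn ε) n m) x.1).2
    ⟨fun n m ↦ ?_, hx2.2.1, hx2.2.2⟩
  rw [mem_selmerTorsion_iff]
  refine ⟨((mem_selmerTorsion_iff _).1 (hx2.1 n m)).1, fun w hw ↦ ?_⟩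
  by_cases hwv : w = v
  · subst hwv
    exact mem_condAboveTorsion_sgn_of_locLevel_mem_localCondTorsion W p κ w hv ε n m (hy.1 n m)
  · have hxw := ((mem_selmerTorsion_iff _).1 (hx2.1 n m)).2 w hw
    rw [PCond.at_of_ne _ _ hwv] at hxw
    exact hxw

end Saturation

/-! ## §4 INPUTS row G67 from EXISTING named facts and the local statement of Prop. 3.8 at `𝔭̄` -/

section Fact

variable {N : ℕ} [NeZero N] {W : WeierstrassCurve ℚ} [W.IsGloballyMinimal] {K : Type} [Field K]
  [NumberField K] {p : ℕ} [Fact p.Prime] {κ : ZpExtension K p} {𝔭 𝔭' : HeightOneSpectrum (𝓞 K)}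

/-- **Castella–Wan's sentence "`Sel_±(K, 𝐓^ac) = Sel^{±,rel}(K, 𝐓^ac)`" — the named fact
`castellaWan2024_proofThm68_selmerRel_le_selmerSgn` (INPUTS row G67) — from EXISTING named facts of the tree
and the LOCAL statement of Prop. 3.8 at `𝔭̄ = 𝔭'`**, fourth reduction. Hypotheses: `IsNonsplitIn κ 𝔭`,
`IsNonsplitIn κ 𝔭'` (one prime of `K_∞` above each of `𝔭`, `𝔭̄`; true in the `Setting`), `Squarefree N` (binder
of the Thm. A.5 fact), the named facts `iovitaPollack2006_lemma21_noPTorsion_top` (proved in the tree, Summit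
side), `castellaWan2024_thmA5_thm68_bdp_mem_charIdeal` (conj. 1 used: "`Sel^{str,rel}` is `Λ^ac`-torsion"),
`castellaWan2024_sec61_localSignedLambdaAdic_free_rank_one` ("`H¹_±(K_𝔭, 𝐓^ac) ≃ Λ^ac`"), and `hsat` —
"`H¹(K_𝔭̄, 𝐓^ac)/H¹_±(K_𝔭̄, 𝐓^ac)` … has trivial `Λ^ac`-torsion by Proposition 3.8" as `Λ`-saturation of
`localSignedLambdaAdic ≤ localLambdaAdic` at `𝔭'` for every local generator matching `γ` (the ONE input that is
neither proved nor a named fact of the tree; the tree has the two carriers but no proof of Prop. 3.8). Then §3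
supplies `hC` of `castellaWan2024_proofThm68_selmerRel_le_selmerSgn_of_thmA5_of_saturated`. BSD is not proved
by this. [cite: CastellaWan2023, proof of Thm. 6.8 (MS p. 30), Prop. 3.8 (MS p. 15), Thm. 6.8 (ii), §6.1 (MS p. 25), Thm. A.5 (MS p. 35)]
[cite: IovitaPollack2006, Lemma 2.1 (arXiv:math/0411496 p. 5)] -/
theorem castellaWan2024_proofThm68_selmerRel_le_selmerSgn_of_thmA5_of_localSaturated
    (h𝔭 : IsNonsplitIn κ 𝔭) (h𝔭' : IsNonsplitIn κ 𝔭') (hsq : Squarefree N)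
    (hE : iovitaPollack2006_lemma21_noPTorsion_top W K p κ 𝔭 𝔭')
    (hA5 : castellaWan2024_thmA5_thm68_bdp_mem_charIdeal N W K p κ 𝔭 𝔭')
    (hH : castellaWan2024_sec61_localSignedLambdaAdic_free_rank_one W K p κ 𝔭 𝔭')
    (hsat : ∀ (_ : Setting W K p κ 𝔭 𝔭') (γ : absoluteGaloisGroup K) (hγ : κ.IsTopGenerator γ) (ε : ℤˣ)
      (γ𝔭' : absoluteGaloisGroup (𝔭'.adicCompletion K))
      (hγ𝔭' : κ (resGalOfEmb (closureEmb (K := K) (𝔭'.adicCompletion K)) γ𝔭') = κ γ),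
      ∀ (g : IwasawaAlgebra p), g ≠ 0 →
        ∀ y : localLambdaAdic ((W.baseChange K).baseChange (𝔭'.adicCompletion K)) p (localizeAt κ 𝔭' h𝔭') γ𝔭',
          (letI := localLambdaAdic.moduleOfGen ((W.baseChange K).baseChange (𝔭'.adicCompletion K)) p
              (localizeAt κ 𝔭' h𝔭') γ𝔭' (isTopGenerator_localize_of_apply_eq p κ _ h𝔭' hγ𝔭' hγ)
           (g • y).1) ∈ localSignedLambdaAdic ((W.baseChange K).baseChange (𝔭'.adicCompletion K)) p
              (localizeAt κ 𝔭' h𝔭') γ𝔭' ε →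
          y.1 ∈ localSignedLambdaAdic ((W.baseChange K).baseChange (𝔭'.adicCompletion K)) p
            (localizeAt κ 𝔭' h𝔭') γ𝔭' ε) :
    castellaWan2024_proofThm68_selmerRel_le_selmerSgn N W K p κ 𝔭 𝔭' := by
  refine castellaWan2024_proofThm68_selmerRel_le_selmerSgn_of_thmA5_of_saturated h𝔭 hsq hE hA5 hH ?_
  intro hS ι f hf hN hHeeg hp hι γ hγ ε _ _ g hg x hgx
  haveI := hS.isElliptic
  haveI : (W.baseChange K).IsElliptic := by rw [WeierstrassCurve.baseChange]; infer_instance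
  obtain ⟨γ𝔭', hγ𝔭'⟩ := exists_apply_resGalOfEmb_closureEmb_eq (p := p) (κ := κ) 𝔭' h𝔭' γ
  exact selmerLambdaAdic_sgn_saturated_of_localSignedLambdaAdic_saturated (W.baseChange K) p κ 𝔭' h𝔭' hS.mem'
    hγ hγ𝔭' ε (hsat hS γ hγ ε γ𝔭' hγ𝔭') g hg x hgx

end Fact

end Literature.NumberTheory.EllipticCurves.AcSigned

end
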